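import Literature.NumberTheory.Automorphic.ArchRankOneCasimirUniform            -- ★ (ELL-∞) frame (LH3-p04 (g4)): the bound functional `F` with `hF`, `torusPoint_ne`, `isCompact_setOf_coe_archLocal_mem`, `circleDiagonal_mem_archLocal_diagonal`
import Literature.NumberTheory.Automorphic.ArchRankOneSplitOrbitSmooth            -- ★ p850603 (F0P3a-p05 (g20)): `contDiff_integral_prod_conj_hypBlockGL_half_param` (split half chart, joint `C^∞` in `(q, x, θ)`); brings the split frame `hypBlockGL`, `unipotentU`
import Literature.NumberTheory.Automorphic.ArchLocalTorusOrbitalBlockSmooth         -- ★ Hörmander engine `Literature.Analysis.Calculus.contDiffAt_integral_comp_of_contDiff_of_support`; ★ `contDiff_coe_circleDiagonal_angles`; ★ `isCompact_setOf_exists_conj_circleDiagonal_mem`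
import Literature.Analysis.Calculus.ParametricSliceJets                           -- (this seat) generic half: `hasFDerivAt_integral_comp_of_contDiff_of_support`, `fderiv_integral_comp_of_contDiff_of_support_apply`, `fderiv_iteratedDeriv_slice_eq[_of_contDiff]`, `contDiff_uncurry_fderiv_apply`
import HarnessLib

/-!
# (B-par) PARAMETRIC DIFFERENTIATION UNDER THE TWO RANK-ONE FUNCTIONALS: the elliptic normalised orbital integral `F(Θ_q)(ψ)` and the split half-chart integral `Λ(Θ_q)(x)` of a
# SMOOTH FAMILY `Θ_q` of test functions are jointly `C^∞` in `(q, ψ)` (`sin ψ ≠ 0`) resp. `(q, x)` (all `x`), and `∂_v` in `q` passes INTO the functional and PAST `∂_ψ^a`, `∂_x^a`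
# (Harish-Chandra ∕ Varadarajan 1977 I §1.12 «smooth dependence on parameters»; Hörmander Thm. 1.1.8–1.1.9)

Topic `NumberTheory/Automorphic`; namespaces `Literature.NumberTheory.Automorphic.RankOneCasimir` (§1, elliptic) and `Literature.NumberTheory.Automorphic.UnitaryGroup` (§2, split).
THEOREMS ONLY (no `def`, no instance, no notation, no axiom, no named fact, no `sorry`); kernel lane `--kind proof --supports stmt-HodgeConjecture-24833`.  Cell `pub/hodgecm-mathlib`,
crux H413 (`stmt-HodgeConjecture-24833`), line LH3 (closer stub `stub_N9`, direct road), LETTER L1 `HcOrbitalFamiliesStatement` clause (I₃) «`ArchHcJump (slotSign L α) jc′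
(orbFamGExt L α ν′ a′)`, all orders, all adapted words, one `jc′`», SPEC-I3 v1.1 (F0P3a-p08 (g23)) §1 brick **(B-par)** (LH3-plan (g3) RULING #16 (b′) 2026-09-02T10:08:47Z;
author F0P3a-p04 (g24)); consumer: (B-trans) «adapted words = nested partials» — a TRANSVERSAL adapted letter `v` differentiates the descended family `Θ♯_q`, and (B-par) is the
licence to move `∂_v` onto `Θ♯` through `F` ∕ `Λ` and past the normal jets.

THE MATHEMATICS.  The two rank-one functionals of the (I₃) road are the ★ (ELL-∞) elliptic one, `F f ψ = (2 sin ψ) • ∫_{G₂} f(↑↑(h t_z(ψ) h⁻¹)) dμ(h)` on `G₂ = U(σ_w diag a)(ℂ)`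
(`t_z(ψ) = diag(z e^{iψ}, z e^{−iψ})`; binder `hF` VERBATIM as in ★ `RankOneCasimir.contDiffOn_orbitalIntegral_punctured`), and the ★ (A0-CASIMIR-∞) split half-chart one
`Λ g x = ∫_{K × N} g(↑↑(k · (t_{0,θ} h_{x∕2} n h_{x∕2}) · k⁻¹)) d(κ ⊗ μ_N)` on `U(J)(ℂ)`, `J = Φ₂` (binder `hΛ` VERBATIM as in ★ `iteratedDeriv_integral_prod_conj_hypBlockGL_half`).
A FAMILY is `Θ : Q → M₂(ℂ) → E` with `ContDiff ℝ ∞ (uncurry Θ)` and ONE compact `C ⊆ M₂(ℂ)` off which every `Θ_q` vanishes (SPEC-I3 §2 class; `Q` finite-dimensional); its parameter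
derivative `∂_v Θ q := X ↦ ∂_v [q′ ↦ Θ q′ X](q)` is again a family (★ generic half `contDiff_uncurry_fderiv_apply`, `forall_fderiv_apply_eq_zero_of_support`).
* §1 ELLIPTIC (any signature `a`, centre `z`, `μ` finite on compacts).  (1a) `exists_isCompact_forall_apply_conj_torusPoint_eq_zero_param`: near `(q₀, ψ₀)` with `sin ψ₀ ≠ 0` the
  integrand vanishes off ONE compact set of `h` (★ `isCompact_setOf_exists_conj_circleDiagonal_mem` over a compact REGULAR arc, ★ `torusPoint_ne`, ★ `isCompact_setOf_coe_archLocal_mem`);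
  (1b) **`contDiffOn_orbitalIntegral_param`: `(q, ψ) ↦ F(Θ_q)(ψ)` is `C^∞` on `univ ×ˢ {sin ψ ≠ 0}`** (Hörmander ★ engine on `Θ(q, A · t_z(ψ) · B)` at `(↑↑h, ↑↑h⁻¹)`);
  (1c) `fderiv_orbitalIntegral_param_apply`: **`∂_v [q ↦ F(Θ_q)(ψ)] = F(∂_v Θ_q)(ψ)`**, every `ψ` (★ generic `fderiv_integral_comp_of_contDiff_of_support_apply`);
  (1d) HEAD `fderiv_iteratedDeriv_orbitalIntegral_param`: **`∂_v [q ↦ ∂_ψ^n F(Θ_q)(ψ)] = ∂_ψ^n F(∂_v Θ_q)(ψ)`, `sin ψ ≠ 0`** (★ generic `fderiv_iteratedDeriv_slice_eq` = Schwarz on the open set).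
* §2 SPLIT (`K ≤ U(J)` compact, `κ`, `μ_N` Haar, `θ` fixed).  (2a) **`contDiff_splitIntegral_param`: `(q, x) ↦ Λ(Θ_q)(x)` is `C^∞` on `Q × ℝ`** (★ p850603
  `contDiff_integral_prod_conj_hypBlockGL_half_param` read in the functional binder); (2b) `fderiv_splitIntegral_param_apply`: **`∂_v [q ↦ Λ(Θ_q)(x)] = Λ(∂_v Θ_q)(x)`**, every `x`
  (uniform compact support on `K × N₀`); (2c) HEAD `fderiv_iteratedDeriv_splitIntegral_param`: **`∂_v [q ↦ ∂_x^n Λ(Θ_q)(x)] = ∂_x^n Λ(∂_v Θ_q)(x)`, all `x`**.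
HONEST LABEL: HC_CM is proved only modulo the 7 printed citations (2 remaining named inputs: hLiu418 = `stmt-HodgeConjecture-24832`, h413 = `stmt-HodgeConjecture-24833`) until
rung 0 closes; parametric bookkeeping over ★ engines, count-neutral (a letter-L1 (I₃) brick; pays nothing by itself).

## References
* [Varadarajan1977] V. S. Varadarajan, *Harmonic Analysis on Real Reductive Groups*, LNM 576 (1977), Part I §1.12 (invariant integrals depending smoothly on parameters).
* [HormanderALPDO1] L. Hörmander, *The Analysis of Linear Partial Differential Operators I*, 2nd ed. (1990), §1.1 Thm. 1.1.8, Thm. 1.1.9.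
* [Shelstad1979] D. Shelstad, *Characters and inner forms of a quasi-split group over ℝ*, Compositio Math. 39 (1979), §4 pp. 22–26 (Lemma 4.3, Prop. 4.5).
* [Bouaziz1994IntegralesOrbitales] A. Bouaziz, *Intégrales orbitales sur les groupes de Lie réductifs*, Ann. Sci. ÉNS 27 (1994), §3.1–3.2 ((I₂)–(I₃)).
* [Rogawski1990] J. D. Rogawski, *Automorphic Representations of Unitary Groups in Three Variables*, Ann. of Math. Stud. 123 (1990), §8.2 pp. 119–123.
-/

set_option autoImplicit false

noncomputable section

/-! ## §1 The elliptic functional `F(Θ_q)(ψ)`: uniform compact support, joint smoothness on `sin ψ ≠ 0`, `∂_v` inside, `∂_v` past `∂_ψ^a` -/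

namespace Literature.NumberTheory.Automorphic.RankOneCasimir

open _root_.Complex _root_.Matrix _root_.MeasureTheory _root_.Set _root_.Filter _root_.Topology _root_.NumberField _root_.NumberField.InfinitePlace
open _root_.Literature.NumberTheory.Automorphic _root_.Literature.NumberTheory.Automorphic.UnitaryGroup _root_.Literature.Analysis.Calculus
open scoped Matrix.Norms.Operator MatrixGroups ComplexConjugate ContDiff Real

variable (L : Type) [Field L] (a : Fin 2 → L) (w : {w : InfinitePlace L // IsComplex w})
variable {E : Type*} [NormedAddCommGroup E] [NormedSpace ℝ E] [CompleteSpace E]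
variable {Q : Type*} [NormedAddCommGroup Q] [NormedSpace ℝ Q] [FiniteDimensional ℝ Q]

/-- The rank-one torus curve `ψ ↦ t_z(ψ) = diag(z e^{iψ}, z e^{−iψ})` is `C^∞` in matrix currency (★ `contDiff_coe_circleDiagonal_angles` along `ψ ↦ (ψ, −ψ)`).
[cite: Rogawski1990, §8.2 p. 119] -/
theorem contDiff_coe_circleDiagonal_torusPoint (z : Circle) :
    ContDiff ℝ ∞ fun ψ : ℝ => ((circleDiagonal 2 ![z * Circle.exp ψ, z * Circle.exp (-ψ)] : GL (Fin 2) ℂ) : Matrix (Fin 2) (Fin 2) ℂ) := by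
  have h := contDiff_coe_circleDiagonal_angles 2 ![z, z]
  have hlin : ContDiff ℝ ∞ fun ψ : ℝ => (![ψ, -ψ] : Fin 2 → ℝ) := by
    refine contDiff_pi.2 fun i => ?_
    fin_cases i
    · exact contDiff_id
    · exact contDiff_neg
  have heq : (fun ψ : ℝ => ((circleDiagonal 2 ![z * Circle.exp ψ, z * Circle.exp (-ψ)] : GL (Fin 2) ℂ) : Matrix (Fin 2) (Fin 2) ℂ)) =
      (fun θ : Fin 2 → ℝ => ((circleDiagonal 2 fun i => ![z, z] i * Circle.exp (θ i) : GL (Fin 2) ℂ) : Matrix (Fin 2) (Fin 2) ℂ)) ∘ fun ψ : ℝ => (![ψ, -ψ] : Fin 2 → ℝ) := by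
    funext ψ
    simp only [Function.comp_apply]
    congr 2
    funext i
    fin_cases i <;> rfl
  rw [heq]
  exact h.comp hlin

omit [NormedSpace ℝ E] [CompleteSpace E] [NormedSpace ℝ Q] [FiniteDimensional ℝ Q] in
/-- **(1a) UNIFORM COMPACT SUPPORT NEAR A REGULAR POINT.**  `diag a` non-degenerate, `Θ : Q → M₂(ℂ) → E` vanishing off one compact `C` for every parameter, `sin ψ₀ ≠ 0`: there are a
neighbourhood `W` of `(q₀, ψ₀)` and ONE compact `S ⊆ G₂` with `Θ_q(↑↑(h t_z(ψ) h⁻¹)) = 0` for all `h ∉ S`, `(q, ψ) ∈ W` (★ `isCompact_setOf_exists_conj_circleDiagonal_mem` over the compact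
REGULAR arc `{t_z(ψ) : |ψ − ψ₀| ≤ δ}`, ★ `torusPoint_ne`, ★ `isCompact_setOf_coe_archLocal_mem`). [cite: Varadarajan1977, I §1.12] [cite: Rogawski1990, §8.2 p. 122] -/
theorem exists_isCompact_forall_apply_conj_torusPoint_eq_zero_param (ha : ∀ i, a i ≠ 0) (z : Circle) (Θ : Q → Matrix (Fin 2) (Fin 2) ℂ → E)
    {C : Set (Matrix (Fin 2) (Fin 2) ℂ)} (hC : IsCompact C) (h0 : ∀ (q : Q) (X : Matrix (Fin 2) (Fin 2) ℂ), X ∉ C → Θ q X = 0)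
    (x₀ : Q × ℝ) (hx₀ : Real.sin x₀.2 ≠ 0) :
    ∃ W ∈ 𝓝 x₀, ∃ S : Set (unitaryGroupOfForm (starRingEnd ℂ) ((Matrix.diagonal a).map w.1.embedding)), IsCompact S ∧
      ∀ h ∉ S, ∀ x ∈ W, Θ x.1 ((((h * ⟨circleDiagonal 2 ![z * Circle.exp x.2, z * Circle.exp (-x.2)], circleDiagonal_mem_archLocal_diagonal L 2 a w _⟩ * h⁻¹ :
        unitaryGroupOfForm (starRingEnd ℂ) ((Matrix.diagonal a).map w.1.embedding)) : GL (Fin 2) ℂ) : Matrix (Fin 2) (Fin 2) ℂ)) = 0 := by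
  -- a closed ball of regular angles around `ψ₀`
  have hopen : IsOpen {ψ : ℝ | Real.sin ψ ≠ 0} := isOpen_ne_fun Real.continuous_sin continuous_const
  obtain ⟨δ, hδ, hball⟩ : ∃ δ > 0, Metric.closedBall x₀.2 δ ⊆ {ψ : ℝ | Real.sin ψ ≠ 0} := by
    obtain ⟨ε, hε, hεball⟩ := Metric.mem_nhds_iff.1 (hopen.mem_nhds (show x₀.2 ∈ {ψ : ℝ | Real.sin ψ ≠ 0} from hx₀))
    exact ⟨ε / 2, half_pos hε, (Metric.closedBall_subset_ball (half_lt_self hε)).trans hεball⟩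
  -- the compact regular arc of torus points
  have htc : Continuous fun ψ : ℝ => (![z * Circle.exp ψ, z * Circle.exp (-ψ)] : Fin 2 → Circle) := by
    refine continuous_pi fun i => ?_
    fin_cases i
    · exact continuous_const.mul Circle.exp.continuous
    · exact continuous_const.mul (Circle.exp.continuous.comp continuous_neg)
  have hKc : IsCompact ((fun ψ : ℝ => (![z * Circle.exp ψ, z * Circle.exp (-ψ)] : Fin 2 → Circle)) '' Metric.closedBall x₀.2 δ) :=
    (isCompact_closedBall x₀.2 δ).image htc
  have hKreg : (fun ψ : ℝ => (![z * Circle.exp ψ, z * Circle.exp (-ψ)] : Fin 2 → Circle)) '' Metric.closedBall x₀.2 δ ⊆ {t : Fin 2 → Circle | Function.Injective t} := by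
    rintro _ ⟨ψ, hψ, rfl⟩
    intro i j hij
    fin_cases i <;> fin_cases j
    · rfl
    · exact absurd hij (torusPoint_ne z (hball hψ))
    · exact absurd hij.symm (torusPoint_ne z (hball hψ))
    · rfl
  -- the compact preimage of `C` in `G₂` and the jointly proper set `S`
  have hC' := isCompact_setOf_coe_archLocal_mem L 2 a w ha hC
  have hS := isCompact_setOf_exists_conj_circleDiagonal_mem L 2 a w ha hKc hKreg hC'
  refine ⟨(Set.univ : Set Q) ×ˢ Metric.closedBall x₀.2 δ, ?_, _, hS, fun h hh x hx => ?_⟩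
  · exact prod_mem_nhds Filter.univ_mem (Metric.closedBall_mem_nhds _ hδ)
  by_contra hne
  apply hh
  refine ⟨![z * Circle.exp x.2, z * Circle.exp (-x.2)], ⟨x.2, (Set.mem_prod.1 hx).2, rfl⟩, ?_⟩
  show _ ∈ {g : archLocal L 2 (Matrix.diagonal a) w | ((g : GL (Fin 2) ℂ) : Matrix (Fin 2) (Fin 2) ℂ) ∈ C}
  by_contra hout
  exact hne (h0 x.1 _ hout)

/-- **(1b) JOINT SMOOTHNESS OF THE ELLIPTIC FUNCTIONAL ON A SMOOTH FAMILY.**  `G₂ = U(σ_w diag a)(ℂ)` of any signature, `μ` finite on compacts, `F` the normalised orbital integral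
(binder `hF`, ★ (ELL-∞) text verbatim), `Θ : Q → M₂(ℂ) → E` jointly `C^∞` with ONE compact support `C`: **`(q, ψ) ↦ F(Θ_q)(ψ)` is `C^∞` on `univ ×ˢ {sin ψ ≠ 0}`** (Hörmander
★ `contDiffAt_integral_comp_of_contDiff_of_support` at each point with (1a)'s uniform compact support; integrand `Θ(q, A · t_z(ψ) · B)` at `(A, B) = (↑↑h, ↑↑h⁻¹)`; times the smooth
scalar `2 sin ψ`). [cite: Varadarajan1977, I §1.12] [cite: HormanderALPDO1, Thm. 1.1.9] [cite: Rogawski1990, §8.2 pp. 122–123] -/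
theorem contDiffOn_orbitalIntegral_param (ha : ∀ i, a i ≠ 0)
    [MeasurableSpace (unitaryGroupOfForm (starRingEnd ℂ) ((Matrix.diagonal a).map w.1.embedding))]
    [BorelSpace (unitaryGroupOfForm (starRingEnd ℂ) ((Matrix.diagonal a).map w.1.embedding))]
    (μ : Measure (unitaryGroupOfForm (starRingEnd ℂ) ((Matrix.diagonal a).map w.1.embedding))) [IsFiniteMeasureOnCompacts μ]
    (z : Circle) (F : (Matrix (Fin 2) (Fin 2) ℂ → E) → ℝ → E)
    (hF : ∀ (f : Matrix (Fin 2) (Fin 2) ℂ → E) (ψ : ℝ), F f ψ = (2 * Real.sin ψ) •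
      ∫ h : unitaryGroupOfForm (starRingEnd ℂ) ((Matrix.diagonal a).map w.1.embedding),
        f (((h * ⟨circleDiagonal 2 ![z * Circle.exp ψ, z * Circle.exp (-ψ)], circleDiagonal_mem_archLocal_diagonal L 2 a w _⟩ * h⁻¹ :
          unitaryGroupOfForm (starRingEnd ℂ) ((Matrix.diagonal a).map w.1.embedding)) : GL (Fin 2) ℂ) : Matrix (Fin 2) (Fin 2) ℂ) ∂μ)
    (Θ : Q → Matrix (Fin 2) (Fin 2) ℂ → E) (hΘ : ContDiff ℝ ∞ (Function.uncurry Θ))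
    (hΘc : ∃ C : Set (Matrix (Fin 2) (Fin 2) ℂ), IsCompact C ∧ ∀ (q : Q) (X : Matrix (Fin 2) (Fin 2) ℂ), X ∉ C → Θ q X = 0) :
    ContDiffOn ℝ ∞ (fun x : Q × ℝ => F (Θ x.1) x.2) ((Set.univ : Set Q) ×ˢ {ψ : ℝ | Real.sin ψ ≠ 0}) := by
  obtain ⟨C, hC, h0⟩ := hΘc
  intro x₀ hx₀
  have hx₀' : Real.sin x₀.2 ≠ 0 := (Set.mem_prod.1 hx₀).2
  refine ContDiffAt.contDiffWithinAt ?_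
  -- the jointly smooth integrand and the continuous datum
  set Ψ : (Matrix (Fin 2) (Fin 2) ℂ × Matrix (Fin 2) (Fin 2) ℂ) × (Q × ℝ) → E :=
    fun p => Θ p.2.1 (p.1.1 * ((circleDiagonal 2 ![z * Circle.exp p.2.2, z * Circle.exp (-p.2.2)] : GL (Fin 2) ℂ) : Matrix (Fin 2) (Fin 2) ℂ) * p.1.2) with hΨ
  have hΨd : ContDiff ℝ ∞ Ψ :=
    hΘ.comp ((contDiff_fst.comp contDiff_snd).prodMk
      (((contDiff_fst.comp contDiff_fst).mul ((contDiff_coe_circleDiagonal_torusPoint z).comp (contDiff_snd.comp contDiff_snd))).mul (contDiff_snd.comp contDiff_fst)))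
  set y : unitaryGroupOfForm (starRingEnd ℂ) ((Matrix.diagonal a).map w.1.embedding) → Matrix (Fin 2) (Fin 2) ℂ × Matrix (Fin 2) (Fin 2) ℂ :=
    fun h => (((h : GL (Fin 2) ℂ) : Matrix (Fin 2) (Fin 2) ℂ), (((h⁻¹ : unitaryGroupOfForm (starRingEnd ℂ) ((Matrix.diagonal a).map w.1.embedding)) : GL (Fin 2) ℂ) :
      Matrix (Fin 2) (Fin 2) ℂ)) with hy
  have hyc : Continuous y :=
    (Units.continuous_val.comp continuous_subtype_val).prodMk ((Units.continuous_val.comp continuous_subtype_val).comp continuous_inv)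
  have hΨy : ∀ (h : unitaryGroupOfForm (starRingEnd ℂ) ((Matrix.diagonal a).map w.1.embedding)) (x : Q × ℝ), Ψ (y h, x) =
      Θ x.1 ((((h * ⟨circleDiagonal 2 ![z * Circle.exp x.2, z * Circle.exp (-x.2)], circleDiagonal_mem_archLocal_diagonal L 2 a w _⟩ * h⁻¹ :
        unitaryGroupOfForm (starRingEnd ℂ) ((Matrix.diagonal a).map w.1.embedding)) : GL (Fin 2) ℂ) : Matrix (Fin 2) (Fin 2) ℂ)) := fun h x => by
    simp only [hΨ, hy, Subgroup.coe_mul, Units.val_mul]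
  -- uniform compact support near `x₀` and the Hörmander engine
  obtain ⟨W, hW, S, hS, hS0⟩ := exists_isCompact_forall_apply_conj_torusPoint_eq_zero_param L a w ha z Θ hC h0 x₀ hx₀'
  have key := contDiffAt_integral_comp_of_contDiff_of_support μ Ψ hΨd y hyc x₀ hS hW (fun h hh x hx => by rw [hΨy]; exact hS0 h hh x hx)
  have hfun : (fun x : Q × ℝ => F (Θ x.1) x.2) = fun x : Q × ℝ => (2 * Real.sin x.2) • ∫ h, Ψ (y h, x) ∂μ := by
    funext x
    rw [hF]
    exact congrArg _ (integral_congr_ae (Eventually.of_forall fun h => (hΨy h x).symm))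
  rw [hfun]
  exact ((contDiff_const.mul (Real.contDiff_sin.comp contDiff_snd)).contDiffAt).smul key

omit [CompleteSpace E] in
/-- **(1c) `∂_v` PASSES INTO THE ELLIPTIC FUNCTIONAL: `∂_v [q ↦ F(Θ_q)(ψ)](q) = F(∂_v Θ_q)(ψ)` for EVERY `ψ`**, `∂_v Θ_q = X ↦ ∂_v[q′ ↦ Θ q′ X](q)` (at a regular `ψ`:
differentiation under the integral sign with (1a)'s uniform compact support, ★ generic `fderiv_integral_comp_of_contDiff_of_support_apply`, and linearity of `(2 sin ψ) •`; at
`sin ψ = 0` both sides vanish). [cite: Varadarajan1977, I §1.12] [cite: HormanderALPDO1, Thm. 1.1.9] -/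
theorem fderiv_orbitalIntegral_param_apply (ha : ∀ i, a i ≠ 0)
    [MeasurableSpace (unitaryGroupOfForm (starRingEnd ℂ) ((Matrix.diagonal a).map w.1.embedding))]
    [BorelSpace (unitaryGroupOfForm (starRingEnd ℂ) ((Matrix.diagonal a).map w.1.embedding))]
    (μ : Measure (unitaryGroupOfForm (starRingEnd ℂ) ((Matrix.diagonal a).map w.1.embedding))) [IsFiniteMeasureOnCompacts μ]
    (z : Circle) (F : (Matrix (Fin 2) (Fin 2) ℂ → E) → ℝ → E)
    (hF : ∀ (f : Matrix (Fin 2) (Fin 2) ℂ → E) (ψ : ℝ), F f ψ = (2 * Real.sin ψ) •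
      ∫ h : unitaryGroupOfForm (starRingEnd ℂ) ((Matrix.diagonal a).map w.1.embedding),
        f (((h * ⟨circleDiagonal 2 ![z * Circle.exp ψ, z * Circle.exp (-ψ)], circleDiagonal_mem_archLocal_diagonal L 2 a w _⟩ * h⁻¹ :
          unitaryGroupOfForm (starRingEnd ℂ) ((Matrix.diagonal a).map w.1.embedding)) : GL (Fin 2) ℂ) : Matrix (Fin 2) (Fin 2) ℂ) ∂μ)
    (Θ : Q → Matrix (Fin 2) (Fin 2) ℂ → E) (hΘ : ContDiff ℝ ∞ (Function.uncurry Θ))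
    (hΘc : ∃ C : Set (Matrix (Fin 2) (Fin 2) ℂ), IsCompact C ∧ ∀ (q : Q) (X : Matrix (Fin 2) (Fin 2) ℂ), X ∉ C → Θ q X = 0)
    (q : Q) (v : Q) (ψ : ℝ) :
    fderiv ℝ (fun q' : Q => F (Θ q') ψ) q v = F (fun X => fderiv ℝ (fun q' : Q => Θ q' X) q v) ψ := by
  obtain ⟨C, hC, h0⟩ := hΘc
  by_cases hψ : Real.sin ψ = 0
  · -- both sides vanish
    have hl : (fun q' : Q => F (Θ q') ψ) = fun _ => (0 : E) := by funext q'; rw [hF, hψ, mul_zero, zero_smul]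
    rw [hl, hF, hψ, mul_zero, zero_smul, fderiv_const_apply]
    rfl
  -- the jointly smooth integrand in the parameter `q` alone (ψ frozen) and the continuous datum
  set Ψ : (Matrix (Fin 2) (Fin 2) ℂ × Matrix (Fin 2) (Fin 2) ℂ) × Q → E :=
    fun p => Θ p.2 (p.1.1 * ((circleDiagonal 2 ![z * Circle.exp ψ, z * Circle.exp (-ψ)] : GL (Fin 2) ℂ) : Matrix (Fin 2) (Fin 2) ℂ) * p.1.2) with hΨ
  have hΨd : ContDiff ℝ ∞ Ψ :=
    hΘ.comp (contDiff_snd.prodMk (((contDiff_fst.comp contDiff_fst).mul contDiff_const).mul (contDiff_snd.comp contDiff_fst)))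
  set y : unitaryGroupOfForm (starRingEnd ℂ) ((Matrix.diagonal a).map w.1.embedding) → Matrix (Fin 2) (Fin 2) ℂ × Matrix (Fin 2) (Fin 2) ℂ :=
    fun h => (((h : GL (Fin 2) ℂ) : Matrix (Fin 2) (Fin 2) ℂ), (((h⁻¹ : unitaryGroupOfForm (starRingEnd ℂ) ((Matrix.diagonal a).map w.1.embedding)) : GL (Fin 2) ℂ) :
      Matrix (Fin 2) (Fin 2) ℂ)) with hy
  have hyc : Continuous y :=
    (Units.continuous_val.comp continuous_subtype_val).prodMk ((Units.continuous_val.comp continuous_subtype_val).comp continuous_inv)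
  have hΨy : ∀ (h : unitaryGroupOfForm (starRingEnd ℂ) ((Matrix.diagonal a).map w.1.embedding)) (q' : Q), Ψ (y h, q') =
      Θ q' ((((h * ⟨circleDiagonal 2 ![z * Circle.exp ψ, z * Circle.exp (-ψ)], circleDiagonal_mem_archLocal_diagonal L 2 a w _⟩ * h⁻¹ :
        unitaryGroupOfForm (starRingEnd ℂ) ((Matrix.diagonal a).map w.1.embedding)) : GL (Fin 2) ℂ) : Matrix (Fin 2) (Fin 2) ℂ)) := fun h q' => by
    simp only [hΨ, hy, Subgroup.coe_mul, Units.val_mul]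
  -- uniform compact support near `q` (slice of (1a) at the frozen `ψ`)
  obtain ⟨W, hW, S, hS, hS0⟩ := exists_isCompact_forall_apply_conj_torusPoint_eq_zero_param L a w ha z Θ hC h0 (q, ψ) hψ
  have hU : {q' : Q | (q', ψ) ∈ W} ∈ 𝓝 q := (Continuous.prodMk_left ψ).continuousAt.preimage_mem_nhds hW
  have hderiv := fderiv_integral_comp_of_contDiff_of_support_apply μ Ψ hΨd y hyc q hS hU (fun h hh q' hq' => by rw [hΨy]; exact hS0 h hh (q', ψ) hq') v
  -- assemble: `F (Θ q') ψ = (2 sin ψ) • ∫ Ψ (y h, q')`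
  have hfun : (fun q' : Q => F (Θ q') ψ) = fun q' : Q => (2 * Real.sin ψ) • ∫ h, Ψ (y h, q') ∂μ := by
    funext q'
    rw [hF]
    exact congrArg _ (integral_congr_ae (Eventually.of_forall fun h => (hΨy h q').symm))
  have hdiffI : DifferentiableAt ℝ (fun q' : Q => ∫ h, Ψ (y h, q') ∂μ) q :=
    (hasFDerivAt_integral_comp_of_contDiff_of_support μ Ψ hΨd y hyc q hS hU (fun h hh q' hq' => by rw [hΨy]; exact hS0 h hh (q', ψ) hq')).differentiableAt
  rw [hfun, fderiv_fun_const_smul hdiffI]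
  show (2 * Real.sin ψ) • fderiv ℝ (fun q' : Q => ∫ h, Ψ (y h, q') ∂μ) q v = _
  rw [hderiv, hF]
  refine congrArg _ (integral_congr_ae (Eventually.of_forall fun h => ?_))
  simp only [hΨy]

/-- **(1d) HEAD, ELLIPTIC: `∂_v` COMMUTES PAST THE NORMAL JETS.**  Under the hypotheses of (1b), for every `q, v`, every regular `ψ` (`sin ψ ≠ 0`) and every order `n`:
**`∂_v [q′ ↦ (F(Θ_{q′}))⁽ⁿ⁾(ψ)](q) = (F(∂_v Θ_q))⁽ⁿ⁾(ψ)`** (★ generic `fderiv_iteratedDeriv_slice_eq` on the open set `univ ×ˢ {sin ≠ 0}` with `G(q, ψ) = F(Θ_q)(ψ)` (1b) and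
`G₁(q, ψ) = F(∂_v Θ_q)(ψ)` (1c)).  With ★ `contDiff_uncurry_fderiv_apply` ∕ `forall_fderiv_apply_eq_zero_of_support` the family class is closed under `∂_v`, so (B-trans) iterates
this along every transversal adapted letter. [cite: Varadarajan1977, I §1.12] [cite: HormanderALPDO1, Thm. 1.1.8] [cite: Bouaziz1994IntegralesOrbitales, §3.2 (I₃)] -/
theorem fderiv_iteratedDeriv_orbitalIntegral_param (ha : ∀ i, a i ≠ 0)
    [MeasurableSpace (unitaryGroupOfForm (starRingEnd ℂ) ((Matrix.diagonal a).map w.1.embedding))]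
    [BorelSpace (unitaryGroupOfForm (starRingEnd ℂ) ((Matrix.diagonal a).map w.1.embedding))]
    (μ : Measure (unitaryGroupOfForm (starRingEnd ℂ) ((Matrix.diagonal a).map w.1.embedding))) [IsFiniteMeasureOnCompacts μ]
    (z : Circle) (F : (Matrix (Fin 2) (Fin 2) ℂ → E) → ℝ → E)
    (hF : ∀ (f : Matrix (Fin 2) (Fin 2) ℂ → E) (ψ : ℝ), F f ψ = (2 * Real.sin ψ) •
      ∫ h : unitaryGroupOfForm (starRingEnd ℂ) ((Matrix.diagonal a).map w.1.embedding),
        f (((h * ⟨circleDiagonal 2 ![z * Circle.exp ψ, z * Circle.exp (-ψ)], circleDiagonal_mem_archLocal_diagonal L 2 a w _⟩ * h⁻¹ :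
          unitaryGroupOfForm (starRingEnd ℂ) ((Matrix.diagonal a).map w.1.embedding)) : GL (Fin 2) ℂ) : Matrix (Fin 2) (Fin 2) ℂ) ∂μ)
    (Θ : Q → Matrix (Fin 2) (Fin 2) ℂ → E) (hΘ : ContDiff ℝ ∞ (Function.uncurry Θ))
    (hΘc : ∃ C : Set (Matrix (Fin 2) (Fin 2) ℂ), IsCompact C ∧ ∀ (q : Q) (X : Matrix (Fin 2) (Fin 2) ℂ), X ∉ C → Θ q X = 0)
    (q : Q) (v : Q) {ψ : ℝ} (hψ : Real.sin ψ ≠ 0) (n : ℕ) :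
    fderiv ℝ (fun q' : Q => iteratedDeriv n (F (Θ q')) ψ) q v = iteratedDeriv n (F (fun X => fderiv ℝ (fun q' : Q => Θ q' X) q v)) ψ := by
  have hU : IsOpen ((Set.univ : Set Q) ×ˢ {ψ : ℝ | Real.sin ψ ≠ 0}) := isOpen_univ.prod (isOpen_ne_fun Real.continuous_sin continuous_const)
  have hG := contDiffOn_orbitalIntegral_param L a w ha μ z F hF Θ hΘ hΘc
  have hG₁ : ∀ y ∈ (Set.univ : Set Q) ×ˢ {ψ : ℝ | Real.sin ψ ≠ 0},
      fderiv ℝ (fun q' : Q => (fun x : Q × ℝ => F (Θ x.1) x.2) (q', y.2)) y.1 v = (fun x : Q × ℝ => F (fun X => fderiv ℝ (fun q' : Q => Θ q' X) x.1 v) x.2) y :=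
    fun y _ => fderiv_orbitalIntegral_param_apply L a w ha μ z F hF Θ hΘ hΘc y.1 v y.2
  exact fderiv_iteratedDeriv_slice_eq hU hG v hG₁ (x := (q, ψ)) (Set.mk_mem_prod (Set.mem_univ q) hψ) n

end Literature.NumberTheory.Automorphic.RankOneCasimir

/-! ## §2 The split half-chart functional `Λ(Θ_q)(x)`: joint smoothness on `Q × ℝ`, `∂_v` inside, `∂_v` past `∂_x^a` -/

namespace Literature.NumberTheory.Automorphic

namespace UnitaryGroup

open _root_.MeasureTheory _root_.MeasureTheory.Measure _root_.Set _root_.Filter _root_.Topology _root_.Complex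
open _root_.Literature.MeasureTheory.Group _root_.Literature.Analysis.Calculus
open _root_.Literature.NumberTheory.Automorphic.UnitaryGroup.HeisRing _root_.Literature.NumberTheory.Automorphic.UnitaryGroup.LineRing
open scoped MatrixGroups ContDiff NNReal
open scoped Matrix.Norms.Operator

section Split

variable {J : Matrix (Fin 2) (Fin 2) ℂ} (hJ : J = (StdForm.antidiagonal 2).over ℂ)
  [MeasurableSpace ↥(unitaryGroupOfForm (starRingEnd ℂ) J)] [BorelSpace ↥(unitaryGroupOfForm (starRingEnd ℂ) J)]
  {K : Subgroup ↥(unitaryGroupOfForm (starRingEnd ℂ) J)} (κ : Measure ↥K)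
  (μN : Measure ↥(unipotentU (starRingEnd ℂ) J)) {E : Type*} [NormedAddCommGroup E] [NormedSpace ℝ E] [CompleteSpace E]
  {Q : Type*} [NormedAddCommGroup Q] [NormedSpace ℝ Q] [FiniteDimensional ℝ Q]

include hJ in
/-- **(2a) JOINT SMOOTHNESS OF THE SPLIT FUNCTIONAL ON A SMOOTH FAMILY**: `K ≤ U(J)` compact, `κ`, `μ_N` Haar, `Λ` the half-chart integral at the angle `θ` (binder `hΛ`, ★ text
verbatim), `Θ : Q → M₂(ℂ) → E` jointly `C^∞` with ONE compact support: **`(q, x) ↦ Λ(Θ_q)(x)` is `C^∞` on `Q × ℝ`** (★ p850603 `contDiff_integral_prod_conj_hypBlockGL_half_param` in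
`(q, x, θ)`, restricted to the fixed `θ`; the compact support on `U(J)` is the preimage of `C` under the closed embedding ★ `isClosedEmbedding_coe_unitaryGroupOfForm_of_eq_over`).
[cite: Varadarajan1977, I §1.12] [cite: Shelstad1979, Lemma 4.3 p. 25] -/
theorem contDiff_splitIntegral_param (hK : IsCompact (K : Set ↥(unitaryGroupOfForm (starRingEnd ℂ) J))) [IsHaarMeasure κ] [IsHaarMeasure μN]
    (θ : ℝ) (Λ : (Matrix (Fin 2) (Fin 2) ℂ → E) → ℝ → E)
    (hΛ : ∀ (g : Matrix (Fin 2) (Fin 2) ℂ → E) (x : ℝ), Λ g x = ∫ p : ↥K × ↥(unipotentU (starRingEnd ℂ) J), g ((((((p.1 : ↥K) : ↥(unitaryGroupOfForm (starRingEnd ℂ) J)) * (((⟨hypBlockGL 0 θ, hypBlockGL_mem_of_eq_over hJ 0 θ⟩ : ↥(unitaryGroupOfForm (starRingEnd ℂ) J))) * ((⟨hypBlockGL (x / 2) 0, hypBlockGL_mem_of_eq_over hJ (x / 2) 0⟩ : ↥(unitaryGroupOfForm (starRingEnd ℂ) J))) * ((p.2 : ↥(unipotentU (starRingEnd ℂ)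 J)) : ↥(unitaryGroupOfForm (starRingEnd ℂ) J)) * ((⟨hypBlockGL (x / 2) 0, hypBlockGL_mem_of_eq_over hJ (x / 2) 0⟩ : ↥(unitaryGroupOfForm (starRingEnd ℂ) J)))) * ((p.1 : ↥K) : ↥(unitaryGroupOfForm (starRingEnd ℂ) J))⁻¹ : ↥(unitaryGroupOfForm (starRingEnd ℂ) J))) : GL (Fin 2) ℂ) : Matrix (Fin 2) (Fin 2) ℂ) ∂(κ.prod μN))
    (Θ : Q → Matrix (Fin 2) (Fin 2) ℂ → E) (hΘ : ContDiff ℝ ∞ (Function.uncurry Θ))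
    (hΘc : ∃ C : Set (Matrix (Fin 2) (Fin 2) ℂ), IsCompact C ∧ ∀ (q : Q) (X : Matrix (Fin 2) (Fin 2) ℂ), X ∉ C → Θ q X = 0) :
    ContDiff ℝ ∞ fun qx : Q × ℝ => Λ (Θ qx.1) qx.2 := by
  obtain ⟨C, hC, h0⟩ := hΘc
  have hS₀ : IsCompact {g : ↥(unitaryGroupOfForm (starRingEnd ℂ) J) | ((g : GL (Fin 2) ℂ) : Matrix (Fin 2) (Fin 2) ℂ) ∈ C} :=
    (isClosedEmbedding_coe_unitaryGroupOfForm_of_eq_over hJ).isCompact_preimage hC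
  have key := contDiff_integral_prod_conj_hypBlockGL_half_param hJ κ μN hK
    (F := fun (q : Q) (g : ↥(unitaryGroupOfForm (starRingEnd ℂ) J)) => Θ q ((g : GL (Fin 2) ℂ) : Matrix (Fin 2) (Fin 2) ℂ))
    (f := Function.uncurry Θ) hΘ (fun _ _ => rfl) hS₀ (fun q g hg => h0 q _ hg)
  have hfun : (fun qx : Q × ℝ => Λ (Θ qx.1) qx.2) = (fun qxθ : Q × ℝ × ℝ => ∫ p : ↥K × ↥(unipotentU (starRingEnd ℂ) J),
      (fun (q : Q) (g : ↥(unitaryGroupOfForm (starRingEnd ℂ) J)) => Θ q ((g : GL (Fin 2) ℂ) : Matrix (Fin 2) (Fin 2) ℂ)) qxθ.1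
        ((p.1 : ↥(unitaryGroupOfForm (starRingEnd ℂ) J)) *
          ((⟨hypBlockGL 0 qxθ.2.2, hypBlockGL_mem_of_eq_over hJ 0 qxθ.2.2⟩ : ↥(unitaryGroupOfForm (starRingEnd ℂ) J)) *
            (⟨hypBlockGL (qxθ.2.1 / 2) 0, hypBlockGL_mem_of_eq_over hJ (qxθ.2.1 / 2) 0⟩ : ↥(unitaryGroupOfForm (starRingEnd ℂ) J)) *
            (p.2 : ↥(unitaryGroupOfForm (starRingEnd ℂ) J)) *
            (⟨hypBlockGL (qxθ.2.1 / 2) 0, hypBlockGL_mem_of_eq_over hJ (qxθ.2.1 / 2) 0⟩ : ↥(unitaryGroupOfForm (starRingEnd ℂ) J))) *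
          (p.1 : ↥(unitaryGroupOfForm (starRingEnd ℂ) J))⁻¹) ∂(κ.prod μN)) ∘ fun qx : Q × ℝ => (qx.1, qx.2, θ) := by
    funext qx
    rw [hΛ]
    rfl
  rw [hfun]
  exact key.comp (contDiff_fst.prodMk (contDiff_snd.prodMk contDiff_const))

omit [CompleteSpace E] in
include hJ in
/-- **(2b) `∂_v` PASSES INTO THE SPLIT FUNCTIONAL: `∂_v [q ↦ Λ(Θ_q)(x)](q) = Λ(∂_v Θ_q)(x)` for EVERY `x`** (differentiation under the integral sign on `K × N`: for all parameters the
integrand is supported in `K × N₀`, `N₀` a compact subset of the closed `N` — `n ∈ (t h)⁻¹ K C′ K h⁻¹`, `C′` the compact preimage of `C` in `U(J)`; ★ generic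
`fderiv_integral_comp_of_contDiff_of_support_apply` with the integrand `Θ(q, A · (t h · B · h) · A′)` smooth in `((A, B, A′), q)` read at `(↑↑k, ↑↑n, ↑↑k⁻¹)`).
[cite: Varadarajan1977, I §1.12] [cite: HormanderALPDO1, Thm. 1.1.9] -/
theorem fderiv_splitIntegral_param_apply (hK : IsCompact (K : Set ↥(unitaryGroupOfForm (starRingEnd ℂ) J))) [IsHaarMeasure κ] [IsHaarMeasure μN]
    (θ : ℝ) (Λ : (Matrix (Fin 2) (Fin 2) ℂ → E) → ℝ → E)
    (hΛ : ∀ (g : Matrix (Fin 2) (Fin 2) ℂ → E) (x : ℝ), Λ g x = ∫ p : ↥K × ↥(unipotentU (starRingEnd ℂ) J), g ((((((p.1 : ↥K) : ↥(unitaryGroupOfForm (starRingEnd ℂ) J)) * (((⟨hypBlockGL 0 θ, hypBlockGL_mem_of_eq_over hJ 0 θ⟩ : ↥(unitaryGroupOfForm (starRingEnd ℂ) J))) * ((⟨hypBlockGL (x / 2) 0, hypBlockGL_mem_of_eq_over hJ (x / 2) 0⟩ : ↥(unitaryGroupOfForm (starRingEnd ℂ) J))) * ((p.2 : ↥(unipotentU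 (starRingEnd ℂ) J)) : ↥(unitaryGroupOfForm (starRingEnd ℂ) J)) * ((⟨hypBlockGL (x / 2) 0, hypBlockGL_mem_of_eq_over hJ (x / 2) 0⟩ : ↥(unitaryGroupOfForm (starRingEnd ℂ) J)))) * ((p.1 : ↥K) : ↥(unitaryGroupOfForm (starRingEnd ℂ) J))⁻¹ : ↥(unitaryGroupOfForm (starRingEnd ℂ) J))) : GL (Fin 2) ℂ) : Matrix (Fin 2) (Fin 2) ℂ) ∂(κ.prod μN))
    (Θ : Q → Matrix (Fin 2) (Fin 2) ℂ → E) (hΘ : ContDiff ℝ ∞ (Function.uncurry Θ))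
    (hΘc : ∃ C : Set (Matrix (Fin 2) (Fin 2) ℂ), IsCompact C ∧ ∀ (q : Q) (X : Matrix (Fin 2) (Fin 2) ℂ), X ∉ C → Θ q X = 0)
    (q : Q) (v : Q) (x : ℝ) :
    fderiv ℝ (fun q' : Q => Λ (Θ q') x) q v = Λ (fun X => fderiv ℝ (fun q' : Q => Θ q' X) q v) x := by
  haveI : LocallyCompactSpace ↥(unitaryGroupOfForm (starRingEnd ℂ) J) := locallyCompactSpace_unitaryGroupOfForm_complex J
  haveI : SecondCountableTopology ↥(unitaryGroupOfForm (starRingEnd ℂ) J) := secondCountableTopology_unitaryGroupOfForm_complex J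
  have hN : IsClosed (unipotentU (starRingEnd ℂ) J : Set ↥(unitaryGroupOfForm (starRingEnd ℂ) J)) := isClosed_unipotentU _ _
  haveI : LocallyCompactSpace ↥(unipotentU (starRingEnd ℂ) J) := hN.isClosedEmbedding_subtypeVal.locallyCompactSpace
  haveI : SecondCountableTopology ↥(unipotentU (starRingEnd ℂ) J) := TopologicalSpace.Subtype.secondCountableTopology _
  haveI : SecondCountableTopology ↥K := TopologicalSpace.Subtype.secondCountableTopology _
  haveI : BorelSpace ↥(unipotentU (starRingEnd ℂ) J) := Subtype.borelSpace _
  haveI : BorelSpace ↥K := Subtype.borelSpace _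
  haveI : BorelSpace (↥K × ↥(unipotentU (starRingEnd ℂ) J)) := Prod.borelSpace
  haveI : CompactSpace ↥K := isCompact_iff_compactSpace.1 hK
  haveI : LocallyCompactSpace ↥K := hK.isClosed.isClosedEmbedding_subtypeVal.locallyCompactSpace
  obtain ⟨C, hC, h0⟩ := hΘc
  have hS₀ : IsCompact {g : ↥(unitaryGroupOfForm (starRingEnd ℂ) J) | ((g : GL (Fin 2) ℂ) : Matrix (Fin 2) (Fin 2) ℂ) ∈ C} :=
    (isClosedEmbedding_coe_unitaryGroupOfForm_of_eq_over hJ).isCompact_preimage hC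
  -- the two fixed movers `t = hyp(0, θ) hyp(x∕2, 0)` and `h = hyp(x∕2, 0)`
  set t : ↥(unitaryGroupOfForm (starRingEnd ℂ) J) := (⟨hypBlockGL 0 θ, hypBlockGL_mem_of_eq_over hJ 0 θ⟩ : ↥(unitaryGroupOfForm (starRingEnd ℂ) J)) *
    (⟨hypBlockGL (x / 2) 0, hypBlockGL_mem_of_eq_over hJ (x / 2) 0⟩ : ↥(unitaryGroupOfForm (starRingEnd ℂ) J)) with ht
  set h : ↥(unitaryGroupOfForm (starRingEnd ℂ) J) := (⟨hypBlockGL (x / 2) 0, hypBlockGL_mem_of_eq_over hJ (x / 2) 0⟩ : ↥(unitaryGroupOfForm (starRingEnd ℂ) J)) with hh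
  -- the jointly smooth integrand `Ψ ((A, B, A′), q) = Θ q (A · (↑↑t · B · ↑↑h) · A′)` and the continuous datum `y (k, n) = (↑↑k, ↑↑n, ↑↑k⁻¹)`
  let P3 := Matrix (Fin 2) (Fin 2) ℂ × Matrix (Fin 2) (Fin 2) ℂ × Matrix (Fin 2) (Fin 2) ℂ
  set Ψ : P3 × Q → E := fun p => Θ p.2 (p.1.1 * ((((t : GL (Fin 2) ℂ) : Matrix (Fin 2) (Fin 2) ℂ) * p.1.2.1 * ((h : GL (Fin 2) ℂ) : Matrix (Fin 2) (Fin 2) ℂ))) * p.1.2.2)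
    with hΨ
  have hΨd : ContDiff ℝ ∞ Ψ := by
    have hA : ContDiff ℝ ∞ fun p : P3 × Q => p.1.1 := contDiff_fst.comp contDiff_fst
    have hB : ContDiff ℝ ∞ fun p : P3 × Q => p.1.2.1 := contDiff_fst.comp (contDiff_snd.comp contDiff_fst)
    have hA' : ContDiff ℝ ∞ fun p : P3 × Q => p.1.2.2 := contDiff_snd.comp (contDiff_snd.comp contDiff_fst)
    exact hΘ.comp (contDiff_snd.prodMk ((hA.mul ((contDiff_const.mul hB).mul contDiff_const)).mul hA'))
  set y : ↥K × ↥(unipotentU (starRingEnd ℂ) J) → P3 := fun p =>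
      ((((p.1 : ↥(unitaryGroupOfForm (starRingEnd ℂ) J)) : GL (Fin 2) ℂ) : Matrix (Fin 2) (Fin 2) ℂ),
        ((((p.2 : ↥(unitaryGroupOfForm (starRingEnd ℂ) J)) : GL (Fin 2) ℂ) : Matrix (Fin 2) (Fin 2) ℂ),
          ((((p.1 : ↥(unitaryGroupOfForm (starRingEnd ℂ) J))⁻¹ : ↥(unitaryGroupOfForm (starRingEnd ℂ) J)) : GL (Fin 2) ℂ) : Matrix (Fin 2) (Fin 2) ℂ))) with hy
  have hcoe : Continuous fun u : ↥(unitaryGroupOfForm (starRingEnd ℂ) J) => ((u : GL (Fin 2) ℂ) : Matrix (Fin 2) (Fin 2) ℂ) :=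
    Units.continuous_val.comp continuous_subtype_val
  have hyc : Continuous y :=
    (hcoe.comp (continuous_subtype_val.comp continuous_fst)).prodMk
      ((hcoe.comp (continuous_subtype_val.comp continuous_snd)).prodMk (hcoe.comp ((continuous_subtype_val.comp continuous_fst).inv)))
  have hΨy : ∀ (p : ↥K × ↥(unipotentU (starRingEnd ℂ) J)) (q' : Q), Ψ (y p, q') =
      Θ q' ((((p.1 : ↥(unitaryGroupOfForm (starRingEnd ℂ) J)) * (t * (p.2 : ↥(unitaryGroupOfForm (starRingEnd ℂ) J)) * h) *
        (p.1 : ↥(unitaryGroupOfForm (starRingEnd ℂ) J))⁻¹ : ↥(unitaryGroupOfForm (starRingEnd ℂ) J)) : GL (Fin 2) ℂ) : Matrix (Fin 2) (Fin 2) ℂ) := fun p q' => by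
    simp only [hΨ, hy, Subgroup.coe_mul, Units.val_mul]
  -- the uniform compact support on `K × N₀`
  obtain ⟨Φ, hΦ⟩ : ∃ Φ : ↥K × ↥(unitaryGroupOfForm (starRingEnd ℂ) J) → ↥(unitaryGroupOfForm (starRingEnd ℂ) J),
      Φ = fun r => t⁻¹ * (((r.1 : ↥K) : ↥(unitaryGroupOfForm (starRingEnd ℂ) J))⁻¹ * r.2 * ((r.1 : ↥K) : ↥(unitaryGroupOfForm (starRingEnd ℂ) J))) * h⁻¹ := ⟨_, rfl⟩
  have hΦc : Continuous Φ := by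
    rw [hΦ]
    have h1 : Continuous fun r : ↥K × ↥(unitaryGroupOfForm (starRingEnd ℂ) J) => ((r.1 : ↥K) : ↥(unitaryGroupOfForm (starRingEnd ℂ) J)) :=
      continuous_subtype_val.comp continuous_fst
    exact (continuous_const.mul ((h1.inv.mul continuous_snd).mul h1)).mul continuous_const
  set S₁ : Set ↥(unitaryGroupOfForm (starRingEnd ℂ) J) :=
    Φ '' ((univ : Set ↥K) ×ˢ {g : ↥(unitaryGroupOfForm (starRingEnd ℂ) J) | ((g : GL (Fin 2) ℂ) : Matrix (Fin 2) (Fin 2) ℂ) ∈ C}) with hS₁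
  have hS₁c : IsCompact S₁ := (isCompact_univ.prod hS₀).image hΦc
  set N₀ : Set ↥(unipotentU (starRingEnd ℂ) J) := Subtype.val ⁻¹' S₁ with hN₀
  have hN₀c : IsCompact N₀ := hN.isClosedEmbedding_subtypeVal.isCompact_preimage hS₁c
  set s : Set (↥K × ↥(unipotentU (starRingEnd ℂ) J)) := univ ×ˢ N₀ with hs
  have hsc : IsCompact s := isCompact_univ.prod hN₀c
  have hzero : ∀ p, p ∉ s → ∀ q' ∈ (univ : Set Q), Ψ (y p, q') = 0 := by
    intro p hp q' _
    rw [hΨy]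
    by_contra hne
    apply hp
    refine mk_mem_prod (mem_univ _) ?_
    change ((p.2 : ↥(unipotentU (starRingEnd ℂ) J)) : ↥(unitaryGroupOfForm (starRingEnd ℂ) J)) ∈ S₁
    have hmem : (p.1 : ↥(unitaryGroupOfForm (starRingEnd ℂ) J)) * (t * (p.2 : ↥(unitaryGroupOfForm (starRingEnd ℂ) J)) * h) *
        (p.1 : ↥(unitaryGroupOfForm (starRingEnd ℂ) J))⁻¹ ∈ {g : ↥(unitaryGroupOfForm (starRingEnd ℂ) J) | ((g : GL (Fin 2) ℂ) : Matrix (Fin 2) (Fin 2) ℂ) ∈ C} := by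
      by_contra hout
      exact hne (h0 q' _ hout)
    refine ⟨(p.1, (p.1 : ↥(unitaryGroupOfForm (starRingEnd ℂ) J)) * (t * (p.2 : ↥(unitaryGroupOfForm (starRingEnd ℂ) J)) * h) *
      (p.1 : ↥(unitaryGroupOfForm (starRingEnd ℂ) J))⁻¹), mk_mem_prod (mem_univ _) hmem, ?_⟩
    rw [hΦ]
    simp only
    group
  have hderiv := fderiv_integral_comp_of_contDiff_of_support_apply (κ.prod μN) Ψ hΨd y hyc q hsc Filter.univ_mem hzero v
  -- the integrand in the verbatim `hΛ` shape
  have hpt : ∀ (p : ↥K × ↥(unipotentU (starRingEnd ℂ) J)) (q' : Q), Ψ (y p, q') = Θ q' ((((((p.1 : ↥K) : ↥(unitaryGroupOfForm (starRingEnd ℂ) J)) * (((⟨hypBlockGL 0 θ, hypBlockGL_mem_of_eq_over hJ 0 θ⟩ : ↥(unitaryGroupOfForm (starRingEnd ℂ) J))) * ((⟨hypBlockGL (x / 2) 0, hypBlockGL_mem_of_eq_over hJ (x / 2) 0⟩ : ↥(unitaryGroupOfForm (starRingEnd ℂ) J))) * ((p.2 : ↥(unipotentU (starRingEnd ℂ)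 J)) : ↥(unitaryGroupOfForm (starRingEnd ℂ) J)) * ((⟨hypBlockGL (x / 2) 0, hypBlockGL_mem_of_eq_over hJ (x / 2) 0⟩ : ↥(unitaryGroupOfForm (starRingEnd ℂ) J)))) * ((p.1 : ↥K) : ↥(unitaryGroupOfForm (starRingEnd ℂ) J))⁻¹ : ↥(unitaryGroupOfForm (starRingEnd ℂ) J))) : GL (Fin 2) ℂ) : Matrix (Fin 2) (Fin 2) ℂ) := by
    intro p q'
    simp only [hΨy, ht, hh]
  -- assemble
  have hfun : (fun q' : Q => Λ (Θ q') x) = fun q' : Q => ∫ p, Ψ (y p, q') ∂(κ.prod μN) := by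
    funext q'
    rw [hΛ]
    exact integral_congr_ae (Eventually.of_forall fun p => (hpt p q').symm)
  rw [hfun, hderiv, hΛ]
  refine integral_congr_ae (Eventually.of_forall fun p => ?_)
  simp only [hpt]

include hJ in
/-- **(2c) HEAD, SPLIT: `∂_v` COMMUTES PAST THE `x`-JETS, ALL `x`.**  Under the hypotheses of (2a), for every `q, v, x` and every order `n`:
**`∂_v [q′ ↦ (Λ(Θ_{q′}))⁽ⁿ⁾(x)](q) = (Λ(∂_v Θ_q))⁽ⁿ⁾(x)`** (★ generic `fderiv_iteratedDeriv_slice_eq_of_contDiff` with `G(q, x) = Λ(Θ_q)(x)` (2a) and `G₁(q, x) = Λ(∂_v Θ_q)(x)` (2b));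
no puncture — the split Cartan has no singular set. [cite: Varadarajan1977, I §1.12] [cite: HormanderALPDO1, Thm. 1.1.8] [cite: Shelstad1979, Lemma 4.3 p. 25] -/
theorem fderiv_iteratedDeriv_splitIntegral_param (hK : IsCompact (K : Set ↥(unitaryGroupOfForm (starRingEnd ℂ) J))) [IsHaarMeasure κ] [IsHaarMeasure μN]
    (θ : ℝ) (Λ : (Matrix (Fin 2) (Fin 2) ℂ → E) → ℝ → E)
    (hΛ : ∀ (g : Matrix (Fin 2) (Fin 2) ℂ → E) (x : ℝ), Λ g x = ∫ p : ↥K × ↥(unipotentU (starRingEnd ℂ) J), g ((((((p.1 : ↥K) : ↥(unitaryGroupOfForm (starRingEnd ℂ) J)) * (((⟨hypBlockGL 0 θ, hypBlockGL_mem_of_eq_over hJ 0 θ⟩ : ↥(unitaryGroupOfForm (starRingEnd ℂ) J))) * ((⟨hypBlockGL (x / 2) 0, hypBlockGL_mem_of_eq_over hJ (x / 2) 0⟩ : ↥(unitaryGroupOfForm (starRingEnd ℂ) J))) * ((p.2 : ↥(unipotentU (starRingEnd ℂ) J)) : ↥(unitaryGroupOfForm (starRingEnd ℂ) J)) * ((⟨hypBlockGL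 (x / 2) 0, hypBlockGL_mem_of_eq_over hJ (x / 2) 0⟩ : ↥(unitaryGroupOfForm (starRingEnd ℂ) J)))) * ((p.1 : ↥K) : ↥(unitaryGroupOfForm (starRingEnd ℂ) J))⁻¹ : ↥(unitaryGroupOfForm (starRingEnd ℂ) J))) : GL (Fin 2) ℂ) : Matrix (Fin 2) (Fin 2) ℂ) ∂(κ.prod μN))
    (Θ : Q → Matrix (Fin 2) (Fin 2) ℂ → E) (hΘ : ContDiff ℝ ∞ (Function.uncurry Θ))
    (hΘc : ∃ C : Set (Matrix (Fin 2) (Fin 2) ℂ), IsCompact C ∧ ∀ (q : Q) (X : Matrix (Fin 2) (Fin 2) ℂ), X ∉ C → Θ q X = 0)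
    (q : Q) (v : Q) (x : ℝ) (n : ℕ) :
    fderiv ℝ (fun q' : Q => iteratedDeriv n (Λ (Θ q')) x) q v = iteratedDeriv n (Λ (fun X => fderiv ℝ (fun q' : Q => Θ q' X) q v)) x := by
  have hG := contDiff_splitIntegral_param hJ κ μN hK θ Λ hΛ Θ hΘ hΘc
  have hG₁ : ∀ y : Q × ℝ, fderiv ℝ (fun q' : Q => (fun qx : Q × ℝ => Λ (Θ qx.1) qx.2) (q', y.2)) y.1 v =
      (fun qx : Q × ℝ => Λ (fun X => fderiv ℝ (fun q' : Q => Θ q' X) qx.1 v) qx.2) y :=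
    fun y => fderiv_splitIntegral_param_apply hJ κ μN hK θ Λ hΛ Θ hΘ hΘc y.1 v y.2
  exact fderiv_iteratedDeriv_slice_eq_of_contDiff hG v hG₁ q x n

end Split

end UnitaryGroup

end Literature.NumberTheory.Automorphic

end
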